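import Summits.CriticalPhenomena.PercolationContinuityZ3.Theorems.Transplant.FKConnectivityAllQSPDefs
import HarnessLib

/-!
# Connectivity correlation inequalities for `φ_{w,q}`, every `q > 0` — the class 𝒦 of BRIDGE–SERIES–PARALLEL two-terminal networks
# (two-terminal networks all of whose 3-connected torsos are `K₄`; DEFINITION)

Definitions file (`--supports stmt-CriticalPhenomena-4575`), census lineage (gen 41) of LANE 2's FK sub-programme; builds on
p205010 (kernel theorem, internal audit signed; external expert review pending).  No named facts, no sorries, nothing probabilistic:
this file only fixes the SYNTAX of the class on which census g39's THEOREM SP(W₄-free) / THEOREM 𝒯₂(𝒦) are to be proved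
(memo HOME/FROM-census-g39-SP-W4FREE.md §1, §3, §11 (v); HOME/FROM-census-g41-*.md).

* `FK.BridgeSep Qac Qad Qbc Qbd Qcd a b c d` — the side conditions of the BRIDGE constructor: the five slot edge sets are pairwise
  disjoint and their spanned vertex sets meet only in the common skeleton vertex (not at all for the two opposite pairs
  `{ac, bd}`, `{ad, bc}`) — literally the vertex-separator hypotheses of the gluing lemmas, as in `FK.IsTTSP`.
* `FK.IsKNet E a b` — the least class of finite edge sets containing the single edges and closed under SERIES and PARALLEL
  composition (exactly the constructors of `FK.IsTTSP`) and under the BRIDGE constructor: the Wheatstone bridge `K₄ − ab` on the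
  poles `a, b` with inner vertices `c, d`, each of its five edges `ac, ad, bc, bd, cd` replaced by a member of the class between the
  corresponding vertices (census g39 §1: `𝒦 := closure of {edge} under SERIES, PARALLEL, BRIDGE`; the `K₄`-substitution
  `Q_ab ∥ BRIDGE(…)` is then a parallel composition).  FACT (Tutte's wheels theorem + the SPQR decomposition; not used, not claimed
  in Lean): the 2-connected graphs `E ∪ {ab}` carried by 𝒦 are exactly the 2-connected graphs with no `W₄` minor, i.e. those all of
  whose 3-connected torsos are `K₄`'s; `FK.IsTTSP ⊂ FK.IsKNet` (`FK.IsTTSP.isKNet`).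
* basic API: `IsKNet.left_mem / right_mem / ne`, `BridgeSep.symm` and `IsKNet.symm` (swap the poles), `IsKNet.card_pos`.
(presearch: the class is classical — Duffin 1965 for series–parallel, Tutte 1961 / Oxley «Matroid Theory» ch. 8 for wheels;
correlation inequalities for `φ_{p,q}`, `q < 1` on it: none in print — corpus + galaxy, census g39 §1.)
[cite: Grimmett2006, §3.9 (pp. 63–64)] [cite: Wagner2006, Thm. 5.8(d), §5.3]
-/

namespace Summit.CriticalPhenomena.PercolationContinuityZ3.Theorems

namespace FK

open scoped Classical

variable {V : Type*}

/-- **Side conditions of the BRIDGE constructor** for the five slots `Qac, Qad, Qbc, Qbd, Qcd` of the Wheatstone bridge `K₄ − ab`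
(poles `a, b`, inner vertices `c, d`): the slots are pairwise edge-disjoint, and the vertex sets they span (`{z | ∃ e ∈ Q, z ∈ e}`)
meet only in the skeleton vertex the two slots share — nowhere for the opposite pairs `{ac, bd}` and `{ad, bc}`. [folklore] -/
structure BridgeSep (Qac Qad Qbc Qbd Qcd : Finset (Sym2 V)) (a b c d : V) : Prop where
  /-- `Qac ∩ Qad = ∅` -/ d_ac_ad : Disjoint Qac Qad
  /-- `Qac ∩ Qbc = ∅` -/ d_ac_bc : Disjoint Qac Qbc
  /-- `Qac ∩ Qbd = ∅` -/ d_ac_bd : Disjoint Qac Qbd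
  /-- `Qac ∩ Qcd = ∅` -/ d_ac_cd : Disjoint Qac Qcd
  /-- `Qad ∩ Qbc = ∅` -/ d_ad_bc : Disjoint Qad Qbc
  /-- `Qad ∩ Qbd = ∅` -/ d_ad_bd : Disjoint Qad Qbd
  /-- `Qad ∩ Qcd = ∅` -/ d_ad_cd : Disjoint Qad Qcd
  /-- `Qbc ∩ Qbd = ∅` -/ d_bc_bd : Disjoint Qbc Qbd
  /-- `Qbc ∩ Qcd = ∅` -/ d_bc_cd : Disjoint Qbc Qcd
  /-- `Qbd ∩ Qcd = ∅` -/ d_bd_cd : Disjoint Qbd Qcd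
  /-- `V(Qac) ∩ V(Qad) ⊆ {a}` -/ v_ac_ad : ∀ z : V, (∃ e ∈ Qac, z ∈ e) → (∃ e ∈ Qad, z ∈ e) → z = a
  /-- `V(Qac) ∩ V(Qbc) ⊆ {c}` -/ v_ac_bc : ∀ z : V, (∃ e ∈ Qac, z ∈ e) → (∃ e ∈ Qbc, z ∈ e) → z = c
  /-- `V(Qac) ∩ V(Qbd) = ∅` -/ v_ac_bd : ∀ z : V, (∃ e ∈ Qac, z ∈ e) → (∃ e ∈ Qbd, z ∈ e) → False
  /-- `V(Qac) ∩ V(Qcd) ⊆ {c}` -/ v_ac_cd : ∀ z : V, (∃ e ∈ Qac, z ∈ e) → (∃ e ∈ Qcd, z ∈ e) → z = c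
  /-- `V(Qad) ∩ V(Qbc) = ∅` -/ v_ad_bc : ∀ z : V, (∃ e ∈ Qad, z ∈ e) → (∃ e ∈ Qbc, z ∈ e) → False
  /-- `V(Qad) ∩ V(Qbd) ⊆ {d}` -/ v_ad_bd : ∀ z : V, (∃ e ∈ Qad, z ∈ e) → (∃ e ∈ Qbd, z ∈ e) → z = d
  /-- `V(Qad) ∩ V(Qcd) ⊆ {d}` -/ v_ad_cd : ∀ z : V, (∃ e ∈ Qad, z ∈ e) → (∃ e ∈ Qcd, z ∈ e) → z = d
  /-- `V(Qbc) ∩ V(Qbd) ⊆ {b}` -/ v_bc_bd : ∀ z : V, (∃ e ∈ Qbc, z ∈ e) → (∃ e ∈ Qbd, z ∈ e) → z = b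
  /-- `V(Qbc) ∩ V(Qcd) ⊆ {c}` -/ v_bc_cd : ∀ z : V, (∃ e ∈ Qbc, z ∈ e) → (∃ e ∈ Qcd, z ∈ e) → z = c
  /-- `V(Qbd) ∩ V(Qcd) ⊆ {d}` -/ v_bd_cd : ∀ z : V, (∃ e ∈ Qbd, z ∈ e) → (∃ e ∈ Qcd, z ∈ e) → z = d

/-- Swapping the poles `a ↔ b` of a bridge: the slots `(Qac, Qad, Qbc, Qbd, Qcd)` become `(Qbc, Qbd, Qac, Qad, Qcd)`. [folklore] -/
theorem BridgeSep.symm {Qac Qad Qbc Qbd Qcd : Finset (Sym2 V)} {a b c d : V} (h : BridgeSep Qac Qad Qbc Qbd Qcd a b c d) :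
    BridgeSep Qbc Qbd Qac Qad Qcd b a c d where
  d_ac_ad := h.d_bc_bd
  d_ac_bc := h.d_ac_bc.symm
  d_ac_bd := h.d_ad_bc.symm
  d_ac_cd := h.d_bc_cd
  d_ad_bc := h.d_ac_bd.symm
  d_ad_bd := h.d_ad_bd.symm
  d_ad_cd := h.d_bd_cd
  d_bc_bd := h.d_ac_ad
  d_bc_cd := h.d_ac_cd
  d_bd_cd := h.d_ad_cd
  v_ac_ad := h.v_bc_bd
  v_ac_bc := fun z h₁ h₂ => h.v_ac_bc z h₂ h₁
  v_ac_bd := fun z h₁ h₂ => h.v_ad_bc z h₂ h₁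
  v_ac_cd := h.v_bc_cd
  v_ad_bc := fun z h₁ h₂ => h.v_ac_bd z h₂ h₁
  v_ad_bd := fun z h₁ h₂ => h.v_ad_bd z h₂ h₁
  v_ad_cd := h.v_bd_cd
  v_bc_bd := h.v_ac_ad
  v_bc_cd := h.v_ac_cd
  v_bd_cd := h.v_ad_cd

/-- Swapping the inner vertices `c ↔ d` of a bridge: the slots become `(Qad, Qac, Qbd, Qbc, Qcd)`. [folklore] -/
theorem BridgeSep.swap_cd {Qac Qad Qbc Qbd Qcd : Finset (Sym2 V)} {a b c d : V} (h : BridgeSep Qac Qad Qbc Qbd Qcd a b c d) :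
    BridgeSep Qad Qac Qbd Qbc Qcd a b d c where
  d_ac_ad := h.d_ac_ad.symm
  d_ac_bc := h.d_ad_bd
  d_ac_bd := h.d_ad_bc
  d_ac_cd := h.d_ad_cd
  d_ad_bc := h.d_ac_bd
  d_ad_bd := h.d_ac_bc
  d_ad_cd := h.d_ac_cd
  d_bc_bd := h.d_bc_bd.symm
  d_bc_cd := h.d_bd_cd
  d_bd_cd := h.d_bc_cd
  v_ac_ad := fun z h₁ h₂ => h.v_ac_ad z h₂ h₁
  v_ac_bc := h.v_ad_bd
  v_ac_bd := h.v_ad_bc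
  v_ac_cd := h.v_ad_cd
  v_ad_bc := h.v_ac_bd
  v_ad_bd := h.v_ac_bc
  v_ad_cd := h.v_ac_cd
  v_bc_bd := fun z h₁ h₂ => h.v_bc_bd z h₂ h₁
  v_bc_cd := h.v_bd_cd
  v_bd_cd := h.v_bc_cd

/-- **The class 𝒦 of bridge–series–parallel two-terminal networks** `IsKNet E a b` (edge set `E`, terminals `a ≠ b`): the least class
of finite edge sets containing the single edges `{s(a, b)}` (`a ≠ b`), closed under SERIES composition at a middle terminal and PARALLEL
composition (the constructors of `FK.IsTTSP`, same side conditions) and under the BRIDGE constructor — the Wheatstone bridge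
`K₄ − ab` on the poles `a, b` with inner vertices `c, d`, its five edges replaced by members of the class (`FK.BridgeSep` side
conditions).  The graphs `E ∪ {ab}` are exactly the 2-connected graphs with no `W₄` minor (census g39 §1; Tutte's wheels theorem —
not used here). [folklore] -/
inductive IsKNet : Finset (Sym2 V) → V → V → Prop
  /-- the single edge `ab`, `a ≠ b` -/
  | edge {a b : V} (hab : a ≠ b) : IsKNet {s(a, b)} a b
  /-- series composition of an `(a, m)`-network and an `(m, b)`-network at the middle terminal `m` -/
  | series {E₁ E₂ : Finset (Sym2 V)} {a m b : V} (h₁ : IsKNet E₁ a m) (h₂ : IsKNet E₂ m b)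
      (hd : Disjoint E₁ E₂) (hV : ∀ z : V, (∃ e ∈ E₁, z ∈ e) → (∃ e ∈ E₂, z ∈ e) → z = m)
      (ha : ∀ e ∈ E₂, a ∉ e) (hb : ∀ e ∈ E₁, b ∉ e) : IsKNet (E₁ ∪ E₂) a b
  /-- parallel composition of two `(a, b)`-networks -/
  | parallel {E₁ E₂ : Finset (Sym2 V)} {a b : V} (h₁ : IsKNet E₁ a b) (h₂ : IsKNet E₂ a b)
      (hd : Disjoint E₁ E₂) (hV : ∀ z : V, (∃ e ∈ E₁, z ∈ e) → (∃ e ∈ E₂, z ∈ e) → z = a ∨ z = b) :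
      IsKNet (E₁ ∪ E₂) a b
  /-- the bridge `K₄ − ab` on the poles `a, b`, inner vertices `c, d`, with 𝒦-networks in its five slots -/
  | bridge {Qac Qad Qbc Qbd Qcd : Finset (Sym2 V)} {a b c d : V} (hac : IsKNet Qac a c) (had : IsKNet Qad a d)
      (hbc : IsKNet Qbc b c) (hbd : IsKNet Qbd b d) (hcd : IsKNet Qcd c d) (hsep : BridgeSep Qac Qad Qbc Qbd Qcd a b c d) :
      IsKNet (Qac ∪ Qad ∪ Qbc ∪ Qbd ∪ Qcd) a b

namespace IsKNet

variable {E : Finset (Sym2 V)} {a b : V}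

/-- The left terminal of a 𝒦-network lies on one of its edges. [folklore] -/
theorem left_mem (h : IsKNet E a b) : ∃ e ∈ E, a ∈ e := by
  induction h with
  | edge hab => exact ⟨_, Finset.mem_singleton_self _, Sym2.mem_mk_left _ _⟩
  | series _ _ _ _ _ _ ih₁ _ =>
    obtain ⟨e, he, ha⟩ := ih₁
    exact ⟨e, Finset.mem_union_left _ he, ha⟩
  | parallel _ _ _ _ ih₁ _ =>
    obtain ⟨e, he, ha⟩ := ih₁
    exact ⟨e, Finset.mem_union_left _ he, ha⟩
  | bridge _ _ _ _ _ _ ihac _ _ _ _ =>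
    obtain ⟨e, he, ha⟩ := ihac
    exact ⟨e, by simp only [Finset.mem_union]; exact Or.inl (Or.inl (Or.inl (Or.inl he))), ha⟩

/-- The right terminal of a 𝒦-network lies on one of its edges. [folklore] -/
theorem right_mem (h : IsKNet E a b) : ∃ e ∈ E, b ∈ e := by
  induction h with
  | edge hab => exact ⟨_, Finset.mem_singleton_self _, Sym2.mem_mk_right _ _⟩
  | series _ _ _ _ _ _ _ ih₂ =>
    obtain ⟨e, he, hb⟩ := ih₂
    exact ⟨e, Finset.mem_union_right _ he, hb⟩
  | parallel _ _ _ _ _ ih₂ =>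
    obtain ⟨e, he, hb⟩ := ih₂
    exact ⟨e, Finset.mem_union_right _ he, hb⟩
  | bridge _ _ hbc _ _ _ _ _ _ _ _ =>
    obtain ⟨e, he, hb⟩ := hbc.left_mem
    exact ⟨e, by simp only [Finset.mem_union]; exact Or.inl (Or.inl (Or.inr he)), hb⟩

/-- The terminals of a 𝒦-network are distinct (for a bridge: `a = b` would lie on `V(Qac) ∩ V(Qbc) ⊆ {c}`, but `a ≠ c`). [folklore] -/
theorem ne (h : IsKNet E a b) : a ≠ b := by
  induction h with
  | edge hab => exact hab
  | series _ h₂ _ _ ha _ _ _ =>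
    obtain ⟨e, he, hb⟩ := h₂.right_mem
    intro hab
    exact ha e he (hab ▸ hb)
  | parallel _ _ _ _ ih₁ _ => exact ih₁
  | bridge hac _ hbc _ _ hsep ihac _ _ _ _ =>
    intro hab
    obtain ⟨e, he, hae⟩ := hac.left_mem
    obtain ⟨f, hf, hbf⟩ := hbc.left_mem
    exact ihac (hsep.v_ac_bc _ ⟨e, he, hae⟩ ⟨f, hf, hab ▸ hbf⟩)

/-- A 𝒦-network has at least one edge. [folklore] -/
theorem card_pos (h : IsKNet E a b) : 0 < E.card := by
  obtain ⟨e, he, _⟩ := h.left_mem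
  exact Finset.card_pos.2 ⟨e, he⟩

/-- **Swapping the poles**: a 𝒦-network between `a` and `b` is a 𝒦-network between `b` and `a` (for a bridge, the slots at `a` and at
`b` change places, `FK.BridgeSep.symm`). [folklore] -/
theorem symm (h : IsKNet E a b) : IsKNet E b a := by
  induction h with
  | @edge a b hab =>
    have he : ({s(a, b)} : Finset (Sym2 V)) = {s(b, a)} := by rw [Sym2.eq_swap]
    rw [he]
    exact IsKNet.edge hab.symm
  | @series E₁ E₂ a m b _ _ hd hV ha hb ih₁ ih₂ =>
    rw [Finset.union_comm]
    exact IsKNet.series ih₂ ih₁ hd.symm (fun z hz₂ hz₁ => hV z hz₁ hz₂) hb ha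
  | @parallel E₁ E₂ a b _ _ hd hV ih₁ ih₂ =>
    exact IsKNet.parallel ih₁ ih₂ hd (fun z hz₁ hz₂ => (hV z hz₁ hz₂).symm)
  | @bridge Qac Qad Qbc Qbd Qcd a b c d hac had hbc hbd hcd hsep _ _ _ _ _ =>
    have hE : Qac ∪ Qad ∪ Qbc ∪ Qbd ∪ Qcd = Qbc ∪ Qbd ∪ Qac ∪ Qad ∪ Qcd := by
      ext e; simp only [Finset.mem_union]; tauto
    rw [hE]
    exact IsKNet.bridge hbc hbd hac had hcd hsep.symm

end IsKNet

/-- **Every two-terminal series–parallel network is a 𝒦-network** (the first three constructors agree). [folklore] -/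
theorem IsTTSP.isKNet {E : Finset (Sym2 V)} {a b : V} (h : IsTTSP E a b) : IsKNet E a b := by
  induction h with
  | edge hab => exact IsKNet.edge hab
  | series _ _ hd hV ha hb ih₁ ih₂ => exact IsKNet.series ih₁ ih₂ hd hV ha hb
  | parallel _ _ hd hV ih₁ ih₂ => exact IsKNet.parallel ih₁ ih₂ hd hV

end FK

end Summit.CriticalPhenomena.PercolationContinuityZ3.Theorems
-- build-touch 2026-08-25T18:27Z T1-D (lead g18): re-land of p402810, declarations byte-identical
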